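import Literature.NumberTheory.Automorphic.TorusPairIntegrandThinSupport
import Literature.NumberTheory.Automorphic.ArchRankinSelbergPairBridge
import Literature.NumberTheory.Automorphic.CornerTorusIwasawaData
import HarnessLib

/-!
# The translated thin pair integrand on the unit box: a finite factor times an archimedean factor

Topic `NumberTheory/Automorphic`; namespace `Literature.NumberTheory.Automorphic`. Theorems only (no
definition, no named fact). Bookkeeping for the bad-place treatment of Corollaire (i)(b) of
Mœglin–Waldspurger (1989) (Cogdell (2004), §4.1: for factorizable data the unfolded Rankin–Selberg
integral is a product of local integrals). Let `W`, `W'` be functions on `GL_n(𝔸_K)` factoring as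
`W(g) = w(g_f) A(g_∞)`, `W'(g) = w'(g_f) A'(g_∞)` (the factorization of the Whittaker function of
`e ⊗ T`, `WhittakerArchFinFactorization`), `D ∈ GL_n(𝔸_K)` with trivial archimedean matrix (a torus of
Whittaker shifts), and `Φ = thinTestFun Φ_∞ T m`. Then at every point `p = (a, k)` of the box
`𝕌_Kⁿ × K`,

  `I_s(W(D ·), W̄'(D ·), Φ)(p) = F(p) · G(a_∞, k_∞)`,
  `F(p) = w(D_f g_f) \overline{w'(D_f g_f)} 𝟙_{thin}(g_f)`,  `g = diag(a) k`,
  `G(y, κ) = A(diag(y) κ) \overline{A'(diag(y) κ)} Φ_∞(e_n diag(y) κ) ∏ᵢ ‖yᵢ‖^{s-(n-1-2i)}`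

(`torusPairIntegrandC_translate_thin_eq_finFactor_mul_archFactor`); the finite factor is invariant
under left multiplication of `p` by the archimedean lifts (`finFactor_archLift_mul`) and continuous as
soon as `w`, `w'` are right invariant under open subgroups (`continuous_of_mul_right_invariant`,
`continuous_finFactor`), and the archimedean factor is continuous (`continuous_archFactor`). These are
the hypotheses of the splitting `exists_const_setIntegral_unitBox_two_valued_mul_eq`
(`UnitBoxFiniteArchSplitting`). [folklore]

## References

* J. W. Cogdell, *Analytic theory of L-functions for GL_n* (2004), §2.3, §4.1 [CogdellAnalyticTheory2004].
* C. Mœglin, J.-L. Waldspurger, *Le spectre résiduel de GL(n)*, Ann. Sci. ÉNS 22 (1989), Appendice,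
  p. 667 [MoeglinWaldspurger1989].
-/

noncomputable section

open MeasureTheory Measure NumberField NumberField.mixedEmbedding IsDedekindDomain Matrix Set
open Literature.NumberTheory.GaloisRepresentations (ideleGroup infiniteIdeles)
open scoped MatrixGroups ComplexConjugate

namespace Literature.NumberTheory.Automorphic

section Pointwise

variable {n : ℕ} {K : Type} [Field K] [NumberField K]

/-- The finite part of the archimedean lift `(x, 1)` of a torus element is trivial. [folklore] -/
theorem sndHom_glDiagonal_infiniteTorusOfMixed (x : Fin n → (mixedSpace K)ˣ) :
    GLn.sndHom n K (glDiagonal n (AdeleRing (𝓞 K) K) (infiniteTorusOfMixed x)) = 1 := by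
  rw [GLn.sndHom_glDiagonal]
  have h : (fun i => Units.map (RingHom.snd (InfiniteAdeleRing K) (FiniteAdeleRing (𝓞 K) K)).toMonoidHom
      (infiniteTorusOfMixed x i)) = fun _ => (1 : (FiniteAdeleRing (𝓞 K) K)ˣ) := by
    funext i
    exact Units.ext rfl
  rw [h]
  exact map_one (glDiagonal n (FiniteAdeleRing (𝓞 K) K))

/-- The finite part of the archimedean lift `(κ, 1)` of an element of `K_∞` is trivial. [folklore] -/
theorem sndHom_maximalCompactOfKinf (κ : ↥(Kinf n K)) :
    GLn.sndHom n K (show GL (Fin n) (AdeleRing (𝓞 K) K) from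
      ((maximalCompactOfKinf κ : ↥(maximalCompactAdelic n K)) : (AdelicGroupData.gl n K).Adelic)) = 1 :=
  GLn.sndHom_ofInfinite _

/-- **The finite part of the torus point is unchanged by an archimedean lift**:
`(diag(a) k)_f` for `(a, k) ↦ ((x, 1) a, (κ, 1) k)`. [folklore] -/
theorem sndHom_torusPoint_archLift_mul (y : (Fin n → (mixedSpace K)ˣ) × ↥(Kinf n K))
    (p : (Fin n → ideleGroup K) × ↥(maximalCompactAdelic n K)) :
    GLn.sndHom n K (torusPoint n K (((infiniteTorusOfMixed y.1, maximalCompactOfKinf y.2) :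
        (Fin n → ideleGroup K) × ↥(maximalCompactAdelic n K)) * p)) =
      GLn.sndHom n K (torusPoint n K p) := by
  obtain ⟨a, k⟩ := p
  have h1 := sndHom_glDiagonal_infiniteTorusOfMixed (K := K) y.1
  have h2 := sndHom_maximalCompactOfKinf (n := n) (K := K) y.2
  have h3 : GLn.sndHom n K ((show GL (Fin n) (AdeleRing (𝓞 K) K) from
        ((maximalCompactOfKinf y.2 : ↥(maximalCompactAdelic n K)) : (AdelicGroupData.gl n K).Adelic)) *
        (show GL (Fin n) (AdeleRing (𝓞 K) K) from ((k : ↥(maximalCompactAdelic n K)) : (AdelicGroupData.gl n K).Adelic))) =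
      GLn.sndHom n K (show GL (Fin n) (AdeleRing (𝓞 K) K) from ((k : ↥(maximalCompactAdelic n K)) : (AdelicGroupData.gl n K).Adelic)) := by
    rw [map_mul, h2, one_mul]
  simp only [torusPoint, Prod.fst_mul, Prod.snd_mul, map_mul]
  rw [h1, one_mul]
  congr 1

/-- **The translated thin pair integrand on the unit box is a finite factor times an archimedean
factor.** For `W(g) = w(g_f) A(g_∞)`, `W'(g) = w'(g_f) A'(g_∞)`, `D` with trivial archimedean matrix,
`Φ = thinTestFun Φ_∞ T m` and `p = (a, k)` with `a ∈ 𝕌_Kⁿ`: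
`I_s(W(D ·), W̄'(D ·), Φ)(p) = [w(D_f g_f) w̄'(D_f g_f) 𝟙_{thin}(g_f)] · [A Ā' Φ_∞ |·|^s δ⁻¹ at (a_∞, k_∞)]`,
`g = diag(a) k`. [cite: CogdellAnalyticTheory2004, §4.1] -/
theorem torusPairIntegrandC_translate_thin_eq_finFactor_mul_archFactor
    {W W' : GL (Fin n) (AdeleRing (𝓞 K) K) → ℂ} {w w' : GL (Fin n) (FiniteAdeleRing (𝓞 K) K) → ℂ}
    {A A' : GL (Fin n) (mixedSpace K) → ℂ}
    (hW : ∀ g, W g = w (GLn.sndHom n K g) * A (GLn.toMixed n K g))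
    (hW' : ∀ g, W' g = w' (GLn.sndHom n K g) * A' (GLn.toMixed n K g))
    {D : GL (Fin n) (AdeleRing (𝓞 K) K)} (hD : GLn.toMixed n K D = 1)
    (Φinf : (Fin n → InfiniteAdeleRing K) → ℝ) (T : Finset (HeightOneSpectrum (𝓞 K))) (m : ℕ) (s : ℂ)
    (p : (Fin n → ideleGroup K) × ↥(maximalCompactAdelic n K))
    (hp : p.1 ∈ unitBox (n := n) (K := K) (Set.univ : Set (HeightOneSpectrum (𝓞 K)))) :
    torusPairIntegrandC n K (fun g => W (D * g)) (fun g => star (W' (D * g))) (thinTestFun n K Φinf T m) s p =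
      (w (GLn.sndHom n K D * GLn.sndHom n K (torusPoint n K p)) *
          conj (w' (GLn.sndHom n K D * GLn.sndHom n K (torusPoint n K p))) *
          thinIndicatorGL n K T m (GLn.sndHom n K (torusPoint n K p))) *
        (A (glDiagonal n (mixedSpace K) (archTorusOfIdele n K p.1) * (kinfOfMaximalCompact n K p.2 : GL (Fin n) (mixedSpace K))) *
          conj (A' (glDiagonal n (mixedSpace K) (archTorusOfIdele n K p.1) *
            (kinfOfMaximalCompact n K p.2 : GL (Fin n) (mixedSpace K)))) *
          ((Φinf (archLastRow n K (glDiagonal n (mixedSpace K) (archTorusOfIdele n K p.1) *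
            (kinfOfMaximalCompact n K p.2 : GL (Fin n) (mixedSpace K)))) : ℝ) : ℂ) *
          archTorusWeightC n K s (archTorusOfIdele n K p.1)) := by
  obtain ⟨a, k⟩ := p
  have htm : GLn.toMixed n K (D * torusPoint n K (a, k)) =
      glDiagonal n (mixedSpace K) (archTorusOfIdele n K a) * (kinfOfMaximalCompact n K k : GL (Fin n) (mixedSpace K)) := by
    rw [map_mul, hD, one_mul, toMixed_torusPoint]
  simp only [torusPairIntegrandC]
  rw [hW, hW', map_mul, htm, ofReal_thinTestFun_lastRow_eq, toMixed_torusPoint, torusWeightC_eq_archTorusWeightC s hp,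
    Complex.star_def, map_mul]
  ring

/-- **A function on a topological group which is right invariant under an open subgroup is
continuous** (it is locally constant). [folklore] -/
theorem continuous_of_mul_right_invariant {G : Type*} [TopologicalSpace G] [Group G] [ContinuousMul G]
    (U : Subgroup G) (hU : IsOpen (U : Set G)) {X : Type*} [TopologicalSpace X] (f : G → X)
    (hf : ∀ u ∈ U, ∀ x, f (x * u) = f x) : Continuous f := by
  refine IsLocallyConstant.continuous ((IsLocallyConstant.iff_exists_open f).2 fun x => ?_)
  refine ⟨(fun u => x * u) '' (U : Set G), (isOpenMap_mul_left x) _ hU, ⟨1, U.one_mem, mul_one x⟩, ?_⟩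
  rintro _ ⟨u, hu, rfl⟩
  exact hf u hu x

/-- **The finite factor is continuous** when `w`, `w'` are right invariant under an open subgroup of
`GL_n(𝔸_K^∞)` and the thin indicator is (`thinIndicatorGL_mul_of_mem_finitePrincipalCongruenceLevel`).
[folklore] -/
theorem continuous_finFactor {w w' : GL (Fin n) (FiniteAdeleRing (𝓞 K) K) → ℂ}
    (U : Subgroup (GL (Fin n) (FiniteAdeleRing (𝓞 K) K))) (hU : IsOpen (U : Set (GL (Fin n) (FiniteAdeleRing (𝓞 K) K))))
    (hw : ∀ u ∈ U, ∀ x, w (x * u) = w x) (hw' : ∀ u ∈ U, ∀ x, w' (x * u) = w' x)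
    {T : Finset (HeightOneSpectrum (𝓞 K))} {m : ℕ} (hθ : ∀ u ∈ U, ∀ x, thinIndicatorGL n K T m (x * u) = thinIndicatorGL n K T m x)
    (Df : GL (Fin n) (FiniteAdeleRing (𝓞 K) K)) :
    Continuous fun p : (Fin n → ideleGroup K) × ↥(maximalCompactAdelic n K) =>
      w (Df * GLn.sndHom n K (torusPoint n K p)) * conj (w' (Df * GLn.sndHom n K (torusPoint n K p))) *
        thinIndicatorGL n K T m (GLn.sndHom n K (torusPoint n K p)) := by
  have hsnd : Continuous fun p : (Fin n → ideleGroup K) × ↥(maximalCompactAdelic n K) => GLn.sndHom n K (torusPoint n K p) :=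
    (GLn.continuous_sndHom (n := n) (K := K)).comp continuous_torusPoint
  have hwc : Continuous w := continuous_of_mul_right_invariant U hU w hw
  have hw'c : Continuous w' := continuous_of_mul_right_invariant U hU w' hw'
  have hθc : Continuous (thinIndicatorGL n K T m) := continuous_of_mul_right_invariant U hU _ hθ
  exact ((hwc.comp ((continuous_const.mul hsnd))).mul
    (Complex.continuous_conj.comp (hw'c.comp (continuous_const.mul hsnd)))).mul (hθc.comp hsnd)

/-- **The finite factor is invariant under the archimedean lifts.** [folklore] -/
theorem finFactor_archLift_mul {w w' : GL (Fin n) (FiniteAdeleRing (𝓞 K) K) → ℂ}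
    {T : Finset (HeightOneSpectrum (𝓞 K))} {m : ℕ} (Df : GL (Fin n) (FiniteAdeleRing (𝓞 K) K))
    (y : (Fin n → (mixedSpace K)ˣ) × ↥(Kinf n K)) (p : (Fin n → ideleGroup K) × ↥(maximalCompactAdelic n K)) :
    (fun p : (Fin n → ideleGroup K) × ↥(maximalCompactAdelic n K) =>
      w (Df * GLn.sndHom n K (torusPoint n K p)) * conj (w' (Df * GLn.sndHom n K (torusPoint n K p))) *
        thinIndicatorGL n K T m (GLn.sndHom n K (torusPoint n K p)))
      (((infiniteTorusOfMixed y.1, maximalCompactOfKinf y.2) : (Fin n → ideleGroup K) × ↥(maximalCompactAdelic n K)) * p) =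
    w (Df * GLn.sndHom n K (torusPoint n K p)) * conj (w' (Df * GLn.sndHom n K (torusPoint n K p))) *
        thinIndicatorGL n K T m (GLn.sndHom n K (torusPoint n K p)) := by
  simp only [sndHom_torusPoint_archLift_mul]

/-- **The archimedean factor is continuous** for continuous `A`, `A'`, `Φ_∞`. [folklore] -/
theorem continuous_archFactor {A A' : GL (Fin n) (mixedSpace K) → ℂ} (hA : Continuous A) (hA' : Continuous A')
    {Φinf : (Fin n → InfiniteAdeleRing K) → ℝ} (hΦ : Continuous Φinf) (s : ℂ) :
    Continuous fun z : (Fin n → (mixedSpace K)ˣ) × ↥(Kinf n K) =>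
      A (glDiagonal n (mixedSpace K) z.1 * (z.2 : GL (Fin n) (mixedSpace K))) *
        conj (A' (glDiagonal n (mixedSpace K) z.1 * (z.2 : GL (Fin n) (mixedSpace K)))) *
        ((Φinf (archLastRow n K (glDiagonal n (mixedSpace K) z.1 * (z.2 : GL (Fin n) (mixedSpace K)))) : ℝ) : ℂ) *
        archTorusWeightC n K s z.1 :=
  (((hA.comp continuous_glDiagonal_mul_kinf).mul (Complex.continuous_conj.comp (hA'.comp continuous_glDiagonal_mul_kinf))).mul
    (Complex.continuous_ofReal.comp (hΦ.comp (continuous_archLastRow.comp continuous_glDiagonal_mul_kinf)))).mul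
    ((continuous_archTorusWeightC s).comp continuous_fst)

end Pointwise

end Literature.NumberTheory.Automorphic
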